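import Mathlib
import Summits.ValiantsHypothesis.ValiantsHypothesis.Theorems.NewtonTauWeak.Negative.Zonogon
import Summits.ValiantsHypothesis.ValiantsHypothesis.Theorems.NewtonUnitEquationsNewtonTauWeakSeparatedRank
import Summits.ValiantsHypothesis.ValiantsHypothesis.Theorems.NewtonUnitEquationsNewtonTauWeakVdpDefs
import Summits.ValiantsHypothesis.ValiantsHypothesis.Theorems.NewtonUnitEquationsNewtonTauWeakStubVertexCharts
import Summits.ValiantsHypothesis.ValiantsHypothesis.Theorems.NewtonUnitEquationsNewtonTauWeakStubChartPairCount
import Summits.ValiantsHypothesis.ValiantsHypothesis.Theorems.NewtonUnitEquationsNewtonTauWeakStubProductVertices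
import Summits.ValiantsHypothesis.ValiantsHypothesis.Theorems.NewtonUnitEquationsNewtonTauWeakHexagonPlanar

/-!
# `NewtonUnitEquationsNewtonTauWeakHexagonChartCount` — Δ-Wronskian rung: the chart count

Rung toward `stub_binomialNewtonTauCommon` (T2 = KPTT Conj. 1 at `t = 2`; crux `NewtonTauWeak`,
stmt-ValiantsHypothesis-5904), line `binomial-normal-form`, lead c3: the GLOBAL Δ-WRONSKIAN argument for sums of
three hexagon products `X(x)·Y(y)·D(xy)` (card `Cruxes/NewtonTauWeak/Lines/binomial-normal-form-delta-global.md`).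

This file: the ABSTRACT CHART COUNT (`hex_chart_count`).  Along a chart `w_t = (σ, t)` (`σ = ±1`), if every
off-diagonal strict top `v` of `F` at a generic time, together with the simultaneous strict top `z` of an auxiliary
`U ≠ 0`, has `v₀ - v₁` among the roots of a nonzero polynomial `P_z` of degree `≤ 2`, OR makes `z + v` the strict top
of an auxiliary `W`, then the chart tops of `F` number at most `2 + 4·#(chart tops of U) + (V(W) + V(U))`: two on the
diagonal (`hex_ncard_tops_sub_eq_le_two`), two per anti-diagonal line and two roots per `z`, and one per realised
pair of simultaneous tops `(top U, top W)` (`stub_chartPairCount` of the vdp line, after base change). [folklore]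
-/

set_option linter.dupNamespace false

noncomputable section

namespace Summit.ValiantsHypothesis.ValiantsHypothesis.Theorems.NewtonUnitEquationsNewtonTauWeak

open scoped BigOperators
open MvPolynomial
open Literature.Computability.AlgebraicComplexity (newtonVertexCount)
open Summit.ValiantsHypothesis.ValiantsHypothesis.Theorems.NewtonTauWeakVdp
open Summit.ValiantsHypothesis.ValiantsHypothesis.Theorems.NewtonTauWeak.Negative (vert)

/-! ## The abstract chart count -/

namespace HexagonThree

/-- At most two strict tops of `F` have their anti-diagonal `e₀ - e₁` cast to `ℂ` equal to a given
complex number (reduction to `hex_ncard_tops_sub_eq_le_two`). [folklore] -/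
theorem ncard_tops_line_complex_le_two (F : MvPolynomial (Fin 2) ℂ) (r : ℂ) :
    {v : Fin 2 →₀ ℕ | (∃ w : Fin 2 → ℝ, IsTop w F v) ∧
      ((((v 0 : ℕ) : ℂ)) - ((v 1 : ℕ) : ℂ)) = r}.ncard ≤ 2 := by
  classical
  by_cases hne : {v : Fin 2 →₀ ℕ | (∃ w : Fin 2 → ℝ, IsTop w F v) ∧
      ((((v 0 : ℕ) : ℂ)) - ((v 1 : ℕ) : ℂ)) = r}.Nonempty
  · obtain ⟨v₀, -, hv₀⟩ := hne
    refine le_trans (Set.ncard_le_ncard ?_ ?_)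
      (hex_ncard_tops_sub_eq_le_two F (((v₀ 0 : ℕ) : ℤ) - ((v₀ 1 : ℕ) : ℤ)))
    · rintro v ⟨hw, hv⟩
      refine ⟨hw, ?_⟩
      have h : ((((v 0 : ℕ) : ℤ) - ((v 1 : ℕ) : ℤ) : ℤ) : ℂ) = ((((v₀ 0 : ℕ) : ℤ) - ((v₀ 1 : ℕ) : ℤ) : ℤ) : ℂ) := by
        push_cast; rw [hv, hv₀]
      exact_mod_cast h
    · exact (ChartPairCount.tops_finite F).subset fun v hv => hv.1
  · rw [Set.not_nonempty_iff_eq_empty.mp hne, Set.ncard_empty]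
    exact Nat.zero_le _

end HexagonThree

open HexagonThree

/-- **Chart count.** Along a chart `w_t = (σ, t)` (`σ = ±1`), suppose every off-diagonal strict top `v`
of `F` at a generic time, together with the simultaneous strict top `z` of `U ≠ 0`, satisfies: `σ_v =
v₀ - v₁` is a root of a nonzero polynomial `P_z` of degree `≤ 2` attached to `z`, OR `z + v` is the strict
top of `W`.  Then the chart tops of `F` number at most `2` (on the diagonal) `+ 4·#(chart tops of U)`
(two roots per `z`, two vertices per anti-diagonal line) `+ (V(W) + V(U))` (the pairs of simultaneous tops
`(top U, top W)`, counted by `stub_chartPairCount`). [folklore] -/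
theorem hex_chart_count (σ : ℝ) (hσ : σ = 1 ∨ σ = -1) (F U W : MvPolynomial (Fin 2) ℂ)
    (Pz : (Fin 2 →₀ ℕ) → Polynomial ℂ) (hPz : ∀ z ∈ U.support, Pz z ≠ 0 ∧ (Pz z).natDegree ≤ 2)
    (htri : ∀ t : ℝ, IsGeneric ![σ, t] → ∀ v z : Fin 2 →₀ ℕ, IsTop ![σ, t] F v → v 0 ≠ v 1 →
      IsTop ![σ, t] U z →
        (Pz z).IsRoot ((((v 0 : ℕ) : ℂ)) - ((v 1 : ℕ) : ℂ)) ∨ IsTop ![σ, t] W (z + v))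
    (hU : U ≠ 0) :
    {v : Fin 2 →₀ ℕ | ∃ t : ℝ, IsGeneric ![σ, t] ∧ IsTop ![σ, t] F v}.ncard ≤
      2 + 4 * {z : Fin 2 →₀ ℕ | ∃ t : ℝ, IsGeneric ![σ, t] ∧ IsTop ![σ, t] U z}.ncard +
        (newtonVertexCount W + newtonVertexCount U) := by
  classical
  set TU := {z : Fin 2 →₀ ℕ | ∃ t : ℝ, IsGeneric ![σ, t] ∧ IsTop ![σ, t] U z} with hTU
  have hTUfin : TU.Finite :=
    U.support.finite_toSet.subset fun z ⟨_, _, hz⟩ => Finset.mem_coe.mpr hz.mem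
  -- the three pieces of the cover
  set Dg := {v : Fin 2 →₀ ℕ | (∃ w : Fin 2 → ℝ, IsTop w F v) ∧ ((v 0 : ℕ) : ℤ) - ((v 1 : ℕ) : ℤ) = 0}
    with hDg
  set L : ℂ → Set (Fin 2 →₀ ℕ) := fun r =>
    {v | (∃ w : Fin 2 → ℝ, IsTop w F v) ∧ ((((v 0 : ℕ) : ℂ)) - ((v 1 : ℕ) : ℂ)) = r} with hL
  set A := ⋃ z ∈ hTUfin.toFinset, ⋃ r ∈ (Pz z).roots.toFinset, L r with hA
  set PS := {ab : (Fin 2 →₀ ℕ) × (Fin 2 →₀ ℕ) | ∃ t : ℝ, IsGeneric ![σ, t] ∧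
      IsTop ![σ, t] (baseChange U) ab.1 ∧ IsTop ![σ, t] (baseChange W) ab.2} with hPS
  set B := (fun ab : (Fin 2 →₀ ℕ) × (Fin 2 →₀ ℕ) => ab.2 - ab.1) '' PS with hB
  -- finiteness
  have hFfin : {v : Fin 2 →₀ ℕ | ∃ w : Fin 2 → ℝ, IsTop w F v}.Finite := ChartPairCount.tops_finite F
  have hDgfin : Dg.Finite := hFfin.subset fun v hv => hv.1
  have hLfin : ∀ r, (L r).Finite := fun r => hFfin.subset fun v hv => hv.1
  have hAfin : A.Finite :=
    Set.Finite.biUnion (Finset.finite_toSet _) fun z _ =>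
      Set.Finite.biUnion (Finset.finite_toSet _) fun r _ => hLfin r
  have hPSfin : PS.Finite := by
    refine (U.support.finite_toSet.prod W.support.finite_toSet).subset ?_
    rintro ⟨a, b⟩ ⟨t, -, ha, hb⟩
    refine ⟨?_, ?_⟩
    · have h := ha.mem
      rw [support_baseChange] at h
      exact Finset.mem_coe.mpr h
    · have h := hb.mem
      rw [support_baseChange] at h
      exact Finset.mem_coe.mpr h
  have hBfin : B.Finite := hPSfin.image _
  -- the cover
  have hcover : {v : Fin 2 →₀ ℕ | ∃ t : ℝ, IsGeneric ![σ, t] ∧ IsTop ![σ, t] F v} ⊆ Dg ∪ A ∪ B := by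
    rintro v ⟨t, ht, hv⟩
    by_cases hvv : v 0 = v 1
    · refine Or.inl (Or.inl ⟨⟨_, hv⟩, ?_⟩)
      rw [hvv]; exact sub_self _
    · obtain ⟨z, hz⟩ := exists_isTop ht hU
      rcases htri t ht v z hv hvv hz with hroot | htop
      · refine Or.inl (Or.inr ?_)
        rw [hA]
        refine Set.mem_iUnion₂.mpr ⟨z, (Set.Finite.mem_toFinset hTUfin).mpr ⟨t, ht, hz⟩, ?_⟩
        refine Set.mem_iUnion₂.mpr ⟨_, ?_, ⟨⟨_, hv⟩, rfl⟩⟩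
        exact Multiset.mem_toFinset.mpr ((Polynomial.mem_roots (hPz z hz.mem).1).mpr hroot)
      · refine Or.inr ⟨(z, z + v), ⟨t, ht, (isTop_baseChange_iff _ _ _).mpr hz,
          (isTop_baseChange_iff _ _ _).mpr htop⟩, ?_⟩
        exact add_tsub_cancel_left z v
  -- the bounds
  have hDle : Dg.ncard ≤ 2 := hex_ncard_tops_sub_eq_le_two F 0
  have hLle : ∀ r, (L r).ncard ≤ 2 := fun r => ncard_tops_line_complex_le_two F r
  have hAle : A.ncard ≤ 4 * TU.ncard := by
    rw [hA, Set.ncard_eq_toFinset_card TU hTUfin]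
    refine (Finset.set_ncard_biUnion_le _ _).trans ?_
    have hz : ∀ z ∈ hTUfin.toFinset, (⋃ r ∈ (Pz z).roots.toFinset, L r).ncard ≤ 4 := by
      intro z hz
      have hzU : z ∈ U.support := by
        obtain ⟨t, -, h⟩ := (Set.Finite.mem_toFinset hTUfin).mp hz
        exact h.mem
      refine (Finset.set_ncard_biUnion_le _ _).trans ?_
      calc ∑ r ∈ (Pz z).roots.toFinset, (L r).ncard ≤ ∑ _r ∈ (Pz z).roots.toFinset, 2 :=
            Finset.sum_le_sum fun r _ => hLle r
        _ = 2 * (Pz z).roots.toFinset.card := by rw [Finset.sum_const, smul_eq_mul, mul_comm]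
        _ ≤ 2 * 2 := by
            gcongr
            exact (Multiset.toFinset_card_le _).trans
              ((Polynomial.card_roots' _).trans (hPz z hzU).2)
        _ = 4 := by norm_num
    calc ∑ z ∈ hTUfin.toFinset, (⋃ r ∈ (Pz z).roots.toFinset, L r).ncard
        ≤ ∑ _z ∈ hTUfin.toFinset, 4 := Finset.sum_le_sum hz
      _ = 4 * hTUfin.toFinset.card := by rw [Finset.sum_const, smul_eq_mul, mul_comm]
  have hBle : B.ncard ≤ newtonVertexCount W + newtonVertexCount U := by
    refine (Set.ncard_image_le hPSfin).trans ?_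
    have h := stub_chartPairCount σ hσ (baseChange W) (baseChange U)
    rw [newtonVertexCount_baseChange, newtonVertexCount_baseChange] at h
    exact h
  calc {v : Fin 2 →₀ ℕ | ∃ t : ℝ, IsGeneric ![σ, t] ∧ IsTop ![σ, t] F v}.ncard
      ≤ (Dg ∪ A ∪ B).ncard := Set.ncard_le_ncard hcover ((hDgfin.union hAfin).union hBfin)
    _ ≤ Dg.ncard + A.ncard + B.ncard :=
        (Set.ncard_union_le _ _).trans (Nat.add_le_add_right (Set.ncard_union_le _ _) _)
    _ ≤ 2 + 4 * TU.ncard + (newtonVertexCount W + newtonVertexCount U) := by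
        gcongr

end Summit.ValiantsHypothesis.ValiantsHypothesis.Theorems.NewtonUnitEquationsNewtonTauWeak

end
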